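import Mathlib
import Summits.QuantumFields.BalabanUV.Beta.AnalyticWalkSum216Recomb

/-!
# [Balaban1988RG2Cluster] p. 3 «we multiply the term in (1.6) corresponding to ω by s(Δ₁)⋯s(Δ_m)» ∕ p. 13 «as before»:
# CONSTRUCTORS of walk-term data — a monomially decorated family (`monoTerm`) and a parameter-free family are `TermData`
# from weighted-row-sum data of the undecorated kernels alone; and the JOINT SATISFIABILITY of the rider-(ρ3) END
# `AnalyticWalkSum216Recomb.woodbury_termSum` (cell topic `Summits/QuantumFields/BalabanUV/Beta`; row-D4 census §10)

HONEST FRAMING (cell rule).  Discharging `BetaPertH` makes Bałaban's UV stability UNCONDITIONAL — a real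
constructive-QFT result; NOT the continuum limit, NOT the Clay problem.  This module discharges NOTHING of `BetaPertH`.
It is the [folklore] hand-off socket of the gen-37 algebra of walk-term families (`AnalyticWalkSum216Algebra` p213336,
`…Neumann` p213525, `…Recomb` p213805): the co-owner road P3's leaf A3-loc (d4-p3, skeleton v1.7 §7.4 (iv)) delivers the
unit-lattice resolvent as a DECORATED sum `G_dec(s) = Σ_γ s^{dec(γ)}·walkTerm_γ` with weighted-row-sum bounds of the
undecorated `walkTerm_γ` (`UnitLatticeWalkTerms.wrs_walkTerm`, `UnitLatticeDecoratedChains.wrs_decoratedSum`) and a bound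
on the decoration monomials; §1 turns exactly such data into `TermData` (one free complex coordinate at a time, the
lineage's convention), so that `termData_recomb` ∕ `woodbury_termSum` apply BY NAME; §2 records that the hypothesis stack of
`woodbury_termSum` together with `TermData` for both input families is jointly inhabited (toy instance, one site).  NO
class change on any GAPS row; NOT summit progress.  Unit `b2b-balaban-beta-an4-g37` (owner of `BINDER-OWNERS.md` row D4);
cell `GAPS.md` C-an4-87 (addendum).

CITATION HEADER (lean-in-tree rule).  [II] = T. Bałaban, *Renormalization group approach to lattice gauge field theories.
II. Cluster expansions*, Commun. Math. Phys. **116**, 1–22 (1988) [Balaban1988RG2Cluster] (journal page = PDF page; render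
`HOME/b2b-balaban-ref1/pages/1988-cmp116-rg-II-cluster/…-p003-x2.png` READ AS IMAGE by this lineage, gens 32–35).  p. 3
[PDF 3], verbatim: *"for a random walk ω localized in X̃₀⁵ ∪ X̃₁⁵ ∪ ⋯ ∪ X̃_n⁵ we take the {Δ₁, …, Δ_m} of all cubes from σ₀
which intersect this localization domain, and we multiply the term in (1.6) corresponding to ω by s(Δ₁)⋯s(Δ_m). This way
the s-dependent propagators H(s), G̃(s), H₀(s) are defined."*  Nothing of [II] is asserted: the sentence LOCATES the
decoration whose data §1 packages; the walk terms and their bounds are HYPOTHESES.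

WHAT IS CERTIFIED HERE (kernel, sorry-free; [folklore]).
§1 `termData_monoTerm` (frozen-factor bound `‖a_w‖r^{e_w} ≤ c_w` + termwise rows `Σ_j c_w‖K_w(i,j)‖e^{κd} ≤ ρ_w` +
   `Summable ρ_w` ⟹ `TermData κ d r (monoTerm a e K) (c‖K‖) ρw`; (i) and (ii) by `AnalyticWalkSum216Monomial` BY NAME),
   `termData_monoTerm_of_wrs` (the same from `WRS κ d (K w) (k_w)` with `ρ_w = c_w k_w`), `termData_const_of_wrs` (a
   parameter-free one-term family — e.g. a σ-independent sandwich factor — from ONE weighted-row-sum bound, any radius).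
§2 `woodbury_termSum_inhabited`: an explicit one-site instance in which the two `TermData` hypotheses and the three
   matrix hypotheses (`IsUnit G`, `IsUnit (1 + cQGP)`, `termSum TL = P(1 + cQGP)⁻¹Q`) of `woodbury_termSum` hold together,
   with its conclusion — the END of rider (ρ3) is not vacuous.
NOT CLAIMED.  Any walk expansion or decoration of Bałaban's operators (A3-loc's output is the intended INPUT); multi-
parameter analyticity.  NO class change on any GAPS row; NOT summit progress.
PRIOR ART IN THE TREE (searched 2026-08-20; nothing re-derived): `AnalyticWalkSum216Monomial` (an4 gen 35:
`differentiableOn_monoTerm`, `norm_monoTerm_le`, `wrs_termSum_sub_monomial` — used BY NAME; it states the END directly,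
this file states the DATA so that the algebra modules compose); `AnalyticWalkSum216Algebra.termData_example` (the
sibling's own inhabitant).
-/

namespace Summit.QuantumFields.BalabanUV.Beta.AnalyticWalkSum216MonoData

open Metric Set
open Literature.MathematicalPhysics.QuantumFieldTheory.Balaban1983to89
open B13PerturbativeStep (WRS WeightHyp wrs)
open Summit.QuantumFields.BalabanUV.Beta.AnalyticWalkSum216 (termSum)
open Summit.QuantumFields.BalabanUV.Beta.AnalyticWalkSum216Monomial (monoTerm differentiableOn_monoTerm
  norm_monoTerm_le)
open Summit.QuantumFields.BalabanUV.Beta.AnalyticWalkSum216Algebra (TermData)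
open Summit.QuantumFields.BalabanUV.Beta.AnalyticWalkSum216Recomb (recombTerm recombMaj recombConst
  woodbury_termSum)

noncomputable section

variable {n : Type*} [Fintype n] {W : Type*} {κ : ℝ} {d : n → n → ℝ}

/-! ## §1 Constructors of term data -/

/-- **A MONOMIALLY DECORATED FAMILY IS `TermData`** on the disc `‖σ‖ < r`: frozen-factor bound `‖a_w‖·r^{e_w} ≤ c_w`,
termwise localised rows of the weighted kernels `Σ_j c_w‖K_w(i,j)‖e^{κd(i,j)} ≤ ρ_w`, and `Summable ρ_w` — analyticity
and the σ-uniform majorant `c_w‖K_w(i,j)‖` are `AnalyticWalkSum216Monomial`'s BY NAME.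
[cite: Balaban1988RG2Cluster, (1.6)–(1.8) p.3] -/
theorem termData_monoTerm {a : W → ℂ} {e : W → ℕ} {c : W → ℝ} {r : ℝ} (hc : ∀ w, ‖a w‖ * r ^ e w ≤ c w)
    (K : W → Matrix n n ℂ) {ρw : W → ℝ} (hrow : ∀ w i, ∑ j, c w * ‖K w i j‖ * Real.exp (κ * d i j) ≤ ρw w)
    (hρw : Summable ρw) : TermData κ d r (monoTerm a e K) (fun w i j => c w * ‖K w i j‖) ρw :=
  ⟨differentiableOn_monoTerm a e K _, norm_monoTerm_le hc K, hrow, hρw⟩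

/-- The same from WEIGHTED-ROW-SUM data of the undecorated kernels: `WRS κ d (K w) (k_w)` and `‖a_w‖r^{e_w} ≤ c_w` with
`c_w ≥ 0` give `TermData` with constants `ρ_w = c_w·k_w` (the shape in which A3-loc states its bounds:
`UnitLatticeWalkTerms.wrs_walkTerm` per cube sequence, decoration monomials bounded by `e^{κ₁·#dec}`). [folklore] -/
theorem termData_monoTerm_of_wrs {a : W → ℂ} {e : W → ℕ} {c : W → ℝ} {r : ℝ} (hc : ∀ w, ‖a w‖ * r ^ e w ≤ c w)
    (hc0 : ∀ w, 0 ≤ c w) (K : W → Matrix n n ℂ) {k : W → ℝ} (hK : ∀ w, WRS κ d (K w) (k w))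
    (hsum : Summable fun w => c w * k w) :
    TermData κ d r (monoTerm a e K) (fun w i j => c w * ‖K w i j‖) (fun w => c w * k w) := by
  refine termData_monoTerm hc K (fun w i => ?_) hsum
  calc ∑ j, c w * ‖K w i j‖ * Real.exp (κ * d i j) = c w * wrs κ d (K w) i := by
        rw [wrs, Finset.mul_sum]
        exact Finset.sum_congr rfl fun j _ => by ring
    _ ≤ c w * k w := mul_le_mul_of_nonneg_left (hK w i) (hc0 w)

/-- **A PARAMETER-FREE ONE-TERM FAMILY IS `TermData`** on every disc: a fixed matrix `K` with `WRS κ d K k` (e.g. a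
σ-independent sandwich factor `Q̂`, `Q̂*` entering a product) — index `Unit`, majorant `‖K(i,j)‖`, constant `k`.
[folklore] -/
theorem termData_const_of_wrs (K : Matrix n n ℂ) {k : ℝ} (hK : WRS κ d K k) (R : ℝ) :
    TermData κ d R (fun (_ : Unit) (_ : ℂ) => K) (fun _ i j => ‖K i j‖) (fun _ => k) where
  ha _ _ _ := differentiableOn_const _
  hm _ _ _ _ _ := le_rfl
  hrow _ i := hK i
  hρw := .of_finite

omit [Fintype n] in
/-- Its summed operator is `K` itself. [folklore] -/
theorem termSum_const (K : Matrix n n ℂ) (σ : ℂ) : termSum (fun (_ : Unit) (_ : ℂ) => K) σ = K := by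
  ext i j
  simp [termSum]

/-! ## §2 The rider-(ρ3) END is not vacuous -/

/-- **JOINT SATISFIABILITY of `woodbury_termSum`'s hypothesis stack.**  One site (`n = Y = Unit`), weight `0`, radius
`1`; `TG` = the parameter-free family of the identity (so `G = 1`, invertible), `P = Q = 1`, `c = 1/2` (so
`1 + cQGP = 3/2 • 1`, invertible), `TL` = the parameter-free family of `(3/2)⁻¹ • 1` (so `termSum TL = P(1 + cQGP)⁻¹Q`);
both families carry `TermData`, and the END identifies `(G⁻¹ + P(c•1)Q)⁻¹` with the summed recombined family.
[folklore] -/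
theorem woodbury_termSum_inhabited :
    ∃ (TG TL : Unit → ℂ → Matrix Unit Unit ℂ) (mG mL : Unit → Unit → Unit → ℝ) (ρG ρL : Unit → ℝ) (c : ℂ)
      (P Q : Matrix Unit Unit ℂ),
      TermData (0 : ℝ) (fun _ _ => (0 : ℝ)) 1 TG mG ρG ∧ TermData (0 : ℝ) (fun _ _ => (0 : ℝ)) 1 TL mL ρL ∧ c ≠ 0 ∧
      IsUnit (termSum TG 0) ∧ IsUnit (1 + c • (Q * termSum TG 0 * P)) ∧
      termSum TL 0 = P * (1 + c • (Q * termSum TG 0 * P))⁻¹ * Q ∧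
      ((termSum TG 0)⁻¹ + P * (c • (1 : Matrix Unit Unit ℂ)) * Q)⁻¹ = termSum (recombTerm TG TL c) 0 := by
  have hw : WeightHyp (n := Unit) (0 : ℝ) (fun _ _ => (0 : ℝ)) :=
    ⟨le_rfl, fun _ => rfl, fun _ _ => le_rfl, fun _ _ _ => by simp⟩
  have add_smul_one_eq : ∀ c : ℂ, (1 + c) • (1 : Matrix Unit Unit ℂ) = 1 + c • (1 : Matrix Unit Unit ℂ) :=
    fun c => by rw [add_smul, one_smul]
  -- the two parameter-free families
  set L : Matrix Unit Unit ℂ := (1 + (1 / 2 : ℂ) • (1 * (1 : Matrix Unit Unit ℂ) * 1))⁻¹ with hL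
  set TG : Unit → ℂ → Matrix Unit Unit ℂ := fun _ _ => (1 : Matrix Unit Unit ℂ) with hTG
  set TL : Unit → ℂ → Matrix Unit Unit ℂ := fun _ _ => ((1 : Matrix Unit Unit ℂ) * L * 1) with hTL
  have hG1 : WRS (0 : ℝ) (fun _ _ => (0 : ℝ)) (1 : Matrix Unit Unit ℂ) 1 := B13PerturbativeStep.WRS.one hw
  have hGdata := termData_const_of_wrs (κ := (0 : ℝ)) (d := fun _ _ => (0 : ℝ)) (1 : Matrix Unit Unit ℂ) hG1 1
  have hL1 : WRS (0 : ℝ) (fun _ _ => (0 : ℝ)) ((1 : Matrix Unit Unit ℂ) * L * 1)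
      (wrs (0 : ℝ) (fun _ _ => (0 : ℝ)) ((1 : Matrix Unit Unit ℂ) * L * 1) ()) := fun i => by
    cases i; exact le_rfl
  have hLdata := termData_const_of_wrs (κ := (0 : ℝ)) (d := fun _ _ => (0 : ℝ)) ((1 : Matrix Unit Unit ℂ) * L * 1) hL1 1
  have hsumG : termSum TG 0 = 1 := termSum_const _ _
  have hsumL : termSum TL 0 = (1 : Matrix Unit Unit ℂ) * L * 1 := termSum_const _ _
  have hc : (1 / 2 : ℂ) ≠ 0 := by norm_num
  have hGu : IsUnit (termSum TG 0) := by rw [hsumG]; exact isUnit_one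
  have hK : IsUnit (1 + (1 / 2 : ℂ) • (1 * termSum TG 0 * 1)) := by
    rw [hsumG, Matrix.mul_one, Matrix.one_mul, ← add_smul_one_eq]
    exact AnalyticWalkSum216Recomb.isUnit_smul_one (by norm_num)
  have hTLeq : termSum TL 0 = 1 * (1 + (1 / 2 : ℂ) • (1 * termSum TG 0 * 1))⁻¹ * 1 := by
    rw [hsumL, hL, hsumG]
  refine ⟨TG, TL, _, _, _, _, (1 / 2 : ℂ), 1, 1, hGdata, hLdata, hc, hGu, hK, hTLeq, ?_⟩
  exact woodbury_termSum hGdata hLdata hw one_pos 1 1 hc (mem_ball_self one_pos) hGu hK hTLeq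

end

end Summit.QuantumFields.BalabanUV.Beta.AnalyticWalkSum216MonoData
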